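import Mathlib
import Literature.Analysis.FluidPDE.GaussianVortexPlanar
import Summits.NavierStokesRegularity.NavierStokesRegularity.Theses.FilamentSkeletonRss

/-!
# Sketch — crux-ideate (round 1, ideator 2) for `CoreGluingGivenInvertibility`
(stmt-NavierStokesRegularity-17944 = `CoreLinearInvertibility → CoreGluing`)

First lemmas of the two idea cards filed by this seat, typed over existing declarations.

* Card A `similarity-semiflow-slow-manifold`:
  - `EnergyDecayUniform` — the Hilbert-space shadow of "uniform-in-circulation decay is a TIME
    statement": `L` dissipative with margin `μ`, `Λ` skew ⇒ every solution of `v' = (L − RΛ)v`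
    decays like `e^{−μt}` for EVERY `R` (Gallay–Wayne's energy identity at `λ = 0`). PROVED below
    (`energyDecayUniform_holds`).
  - `UniformPlanarSemigroupDecay` — the parabolic twin of the crux hypothesis
    `CoreLinearInvertibility`: uniform-in-`R` exponential decay of classical solutions of
    `∂ₛ w = T_{λ,R} w` on the constrained subspace in `L²(G_λ⁻¹)` (the first real stub of line A).
* Card B `all-orders-dressing-polynomial-loss`:
  - `PlanarCellSolvable` and `CellSolvableOfInvertibility := CoreLinearInvertibility → PlanarCellSolvable`
    — the a-priori bound of the crux hypothesis turned into the Fredholm alternative that solves the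
    planar cell problems of the all-orders slender-body expansion (the step that USES `hL`).
  - `QuadraticNewton` — the closure lemma "accuracy beats a poor constant": residual `ε`, right
    inverse of size `K`, quadratic remainder `Q`, `8K²Qε < 1` ⇒ an exact zero within `2Kε`.
-/

set_option linter.dupNamespace false

noncomputable section

namespace Summit.NavierStokesRegularity.NavierStokesRegularity.Cruxes.CoreGluingGivenInvertibility.Ideator2

open scoped InnerProductSpace RealInnerProductSpace Topology
open MeasureTheory Filter Set Literature.Analysis.FluidPDE
open Summit.NavierStokesRegularity.NavierStokesRegularity.Theses.FilamentSkeletonRss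

/-! ## Card A — first lemma (abstract shadow): dissipative + skew ⇒ decay uniform in the skew coupling -/

/-- In a real Hilbert space, if `⟪L v, v⟫ ≤ −μ‖v‖²` and `⟪Λ v, v⟫ = 0`, then every `C¹` solution of
`v' = L v − R Λ v` obeys `‖v t‖ ≤ e^{−μ t} ‖v 0‖` for `t ≥ 0`, with NO dependence on `R`
(Gallay–Wayne 2005/2006 energy identity for `L − αΛ` in `L²(G⁻¹)`; Gallay–Maekawa 2011 p. 5). -/
def EnergyDecayUniform : Prop :=
  ∀ (E : Type) [NormedAddCommGroup E] [InnerProductSpace ℝ E]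
    (L Λ : E →L[ℝ] E) (μ R : ℝ),
    (∀ v : E, ⟪L v, v⟫_ℝ ≤ -μ * ‖v‖ ^ 2) → (∀ v : E, ⟪Λ v, v⟫_ℝ = 0) →
    ∀ v : ℝ → E, (∀ t, HasDerivAt v (L (v t) - R • Λ (v t)) t) →
    ∀ t, 0 ≤ t → ‖v t‖ ≤ Real.exp (-μ * t) * ‖v 0‖

theorem energyDecayUniform_holds : EnergyDecayUniform := by
  intro E _ _ L Λ μ R hL hΛ v hv t ht
  -- f t = ‖v t‖², g t = exp(2μt) f t is non-increasing
  have hf : ∀ s, HasDerivAt (fun s => ⟪v s, v s⟫_ℝ)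
      (⟪v s, L (v s) - R • Λ (v s)⟫_ℝ + ⟪L (v s) - R • Λ (v s), v s⟫_ℝ) s := by
    intro s
    exact (hv s).inner ℝ (hv s)
  have hkey : ∀ s, ⟪v s, L (v s) - R • Λ (v s)⟫_ℝ + ⟪L (v s) - R • Λ (v s), v s⟫_ℝ
      ≤ -(2 * μ) * ⟪v s, v s⟫_ℝ := by
    intro s
    have h1 : ⟪L (v s) - R • Λ (v s), v s⟫_ℝ = ⟪L (v s), v s⟫_ℝ := by
      rw [inner_sub_left, inner_smul_left]
      simp [hΛ (v s)]
    have h2 : ⟪v s, L (v s) - R • Λ (v s)⟫_ℝ = ⟪L (v s), v s⟫_ℝ := by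
      rw [real_inner_comm]; exact h1
    rw [h1, h2, real_inner_self_eq_norm_sq]
    have := hL (v s)
    nlinarith
  let g : ℝ → ℝ := fun s => Real.exp (2 * μ * s) * ⟪v s, v s⟫_ℝ
  have hg : ∀ s, HasDerivAt g (2 * μ * Real.exp (2 * μ * s) * ⟪v s, v s⟫_ℝ +
      Real.exp (2 * μ * s) * (⟪v s, L (v s) - R • Λ (v s)⟫_ℝ + ⟪L (v s) - R • Λ (v s), v s⟫_ℝ)) s := by
    intro s
    have he : HasDerivAt (fun s => Real.exp (2 * μ * s)) (2 * μ * Real.exp (2 * μ * s)) s := by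
      have h := ((hasDerivAt_id s).const_mul (2 * μ)).exp
      simp only [mul_one, id] at h
      convert h using 1; ring
    exact he.mul (hf s)
  have hg' : ∀ s, deriv g s ≤ 0 := by
    intro s
    rw [(hg s).deriv]
    have hpos : 0 < Real.exp (2 * μ * s) := Real.exp_pos _
    have := hkey s
    nlinarith [hpos, this]
  have hdiff : Differentiable ℝ g := fun s => (hg s).differentiableAt
  have hanti : Antitone g := antitone_of_deriv_nonpos hdiff hg'
  have hgt : g t ≤ g 0 := hanti ht
  have hg0 : g 0 = ‖v 0‖ ^ 2 := by
    simp [g]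
  have hgt' : g t = Real.exp (2 * μ * t) * ‖v t‖ ^ 2 := by
    simp [g]
  rw [hg0, hgt'] at hgt
  -- ‖v t‖² ≤ exp(-2μt) ‖v 0‖² = (exp(-μ t) ‖v 0‖)²
  have hexp : Real.exp (2 * μ * t) * Real.exp (-μ * t) ^ 2 = 1 := by
    rw [← Real.exp_nat_mul, ← Real.exp_add]
    convert Real.exp_zero using 2; push_cast; ring
  have hsq : ‖v t‖ ^ 2 ≤ (Real.exp (-μ * t) * ‖v 0‖) ^ 2 := by
    have hpos : 0 < Real.exp (2 * μ * t) := Real.exp_pos _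
    have : Real.exp (2 * μ * t) * ‖v t‖ ^ 2 ≤ Real.exp (2 * μ * t) * (Real.exp (-μ * t) * ‖v 0‖) ^ 2 := by
      calc Real.exp (2 * μ * t) * ‖v t‖ ^ 2 ≤ ‖v 0‖ ^ 2 := hgt
        _ = Real.exp (2 * μ * t) * (Real.exp (-μ * t) * ‖v 0‖) ^ 2 := by
          rw [mul_pow, ← mul_assoc, hexp, one_mul]
    exact le_of_mul_le_mul_left this hpos
  have hnn : 0 ≤ Real.exp (-μ * t) * ‖v 0‖ := by positivity
  by_contra h
  push Not at h
  nlinarith [hsq, hnn, norm_nonneg (v t), h, mul_nonneg hnn (le_of_lt (sub_pos.2 h))]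

/-! ## Card A — first real stub: the parabolic twin of `CoreLinearInvertibility` -/

/-- **Uniform planar semigroup decay** (line A, stub 1). For every asymmetry `λ ∈ [0,1)` there are
`R₀, C, η > 0` such that for all circulation Reynolds numbers `R ≥ R₀`, every classical solution
`w(s,x)` of the linearised strained-vortex equation `∂ₛw = T_{λ,R} w`,
`T_{λ,R} w = L_λ w − R (v^G·∇w + (K_{2D}∗w)·∇G)` (vocabulary of
`Literature.Analysis.FluidPDE.GaussianVortexPlanar`, exactly as in the crux hypothesis
`CoreLinearInvertibility`), with finite `L²(G_λ⁻¹)` norms, convergent Biot–Savart integrals and zero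
mass and first moments initially, decays: `∫G_λ⁻¹ w(s)² ≤ C² e^{−2ηs} ∫G_λ⁻¹ w(0)²` — the constant
`C` and rate `η` INDEPENDENT of `R`. Known: `λ = 0` with `C = 1`, `η = 1/2` (skew-adjointness of `Λ` in
`L²(G⁻¹)`, `EnergyDecayUniform`); uniform RATE for the 3-D column (Gallay–Maekawa 2011 Thm 1.1, gap
`1/2` for all circulations, constants NOT uniform in polynomial weights); open for `λ ∈ (0,1)` exactly
like the steady bound of stmt-17973 (Gearhart–Prüss: this is the resolvent bound on a half-plane, the
crux hypothesis is the resolvent bound at `z = 0`). -/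
def UniformPlanarSemigroupDecay : Prop :=
  ∀ lam ∈ Set.Ico (0 : ℝ) 1, ∃ R₀ C η : ℝ, 0 < C ∧ 0 < η ∧ ∀ R : ℝ, R₀ ≤ R →
    ∀ w : ℝ → EuclideanSpace ℝ (Fin 2) → ℝ,
      (∀ s, ContDiff ℝ 2 (w s)) →
      (∀ s x, HasDerivAt (fun σ => w σ x)
        (strainedVorticityOperator lam (w s) x -
          R * (⟪gaussVortexVelocity x, gradient (w s) x⟫_ℝ +
               ⟪biotSavart2D (w s) x, gradient gaussVortexProfile x⟫_ℝ)) s) →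
      (∀ s x, Integrable (fun y => w s y • biotSavartKernel2D (x - y))) →
      (∀ s, Integrable (fun x => (gaussWeightLam lam x)⁻¹ * w s x ^ 2)) →
      (∫ x, w 0 x = 0) → (∫ x, x 0 * w 0 x = 0) → (∫ x, x 1 * w 0 x = 0) →
      ∀ s, 0 ≤ s →
        ∫ x, (gaussWeightLam lam x)⁻¹ * w s x ^ 2 ≤
          C ^ 2 * Real.exp (-2 * η * s) * ∫ x, (gaussWeightLam lam x)⁻¹ * w 0 x ^ 2

/-! ## Card B — first lemma: the crux hypothesis as a Fredholm alternative (the cell solver) -/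

/-- **Planar cell solvability** (line B, stub 1 conclusion). For `λ ∈ [0,1)` and `R ≥ R₀(λ)`: every
smooth right-hand side `f` with finite `L²(G_λ⁻¹)` norm and zero mass and first moments is
`T_{λ,R} w` for some `C²` constrained `w` with finite weighted norm and convergent Biot–Savart
integrals — the order-by-order CROSS-SECTIONAL CELL PROBLEM of the all-orders slender-body dressing
(Moffatt–Kida–Ohkitani / Callegari–Ting cells at each filament station). -/
def PlanarCellSolvable : Prop :=
  ∀ lam ∈ Set.Ico (0 : ℝ) 1, ∃ R₀ : ℝ, ∀ R : ℝ, R₀ ≤ R →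
    ∀ f : EuclideanSpace ℝ (Fin 2) → ℝ, ContDiff ℝ (⊤ : ℕ∞) f →
      Integrable (fun x => (gaussWeightLam lam x)⁻¹ * f x ^ 2) →
      (∫ x, f x = 0) → (∫ x, x 0 * f x = 0) → (∫ x, x 1 * f x = 0) →
      ∃ w : EuclideanSpace ℝ (Fin 2) → ℝ, ContDiff ℝ 2 w ∧
        Integrable (fun x => (gaussWeightLam lam x)⁻¹ * w x ^ 2) ∧
        (∀ x, Integrable (fun y => w y • biotSavartKernel2D (x - y))) ∧
        (∫ x, w x = 0) ∧ (∫ x, x 0 * w x = 0) ∧ (∫ x, x 1 * w x = 0) ∧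
        ∀ x, strainedVorticityOperator lam w x -
          R * (⟪gaussVortexVelocity x, gradient w x⟫_ℝ +
               ⟪biotSavart2D w x, gradient gaussVortexProfile x⟫_ℝ) = f x

/-- **The step that uses `hL`** (line B, stub 1): the a-priori bound `CoreLinearInvertibility`
(injectivity + closed range of `T_{λ,R}` on the constrained weighted space, uniformly in `R`) plus
index zero (`L_λ` self-adjoint with compact resolvent in `L²(G_λ⁻¹)`, the advection pair
`L_λ`-compact) give surjectivity onto the constrained space: the Fredholm alternative. -/
def CellSolvableOfInvertibility : Prop :=
  CoreLinearInvertibility → PlanarCellSolvable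

/-! ## Card B — closure lemma: accuracy beats a poor constant -/

/-- **Quadratic Newton / "accuracy beats a poor constant"** (line B, last stub, abstract form).
`Φ : E → F` with a bounded right inverse `S` of its linearisation `A` at `u₀` (`‖S‖ ≤ K`, as large as
a polynomial `Γ^C`), a quadratic remainder constant `Q` on the ball of radius `2Kε`, and residual
`‖Φ u₀‖ ≤ ε` (as small as `Γ^{-M}` from the all-orders dressing): if `8K²Qε < 1` there is an exact
zero with `‖u − u₀‖ ≤ 2Kε` (contraction for `g ↦ −Φ(u₀) − [Φ(u₀+Sg) − Φ(u₀) − A S g]` on `‖g‖ ≤ 2ε`). -/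
def QuadraticNewton : Prop :=
  ∀ (E F : Type) [NormedAddCommGroup E] [NormedSpace ℝ E] [NormedAddCommGroup F] [NormedSpace ℝ F]
    [CompleteSpace F] (Φ : E → F) (A : E →L[ℝ] F) (S : F →L[ℝ] E) (u₀ : E) (K Q ε : ℝ),
    0 ≤ K → 0 ≤ Q → 0 ≤ ε → (∀ f, A (S f) = f) → ‖S‖ ≤ K → ‖Φ u₀‖ ≤ ε →
    (∀ u v, ‖u - u₀‖ ≤ 2 * K * ε → ‖v - u₀‖ ≤ 2 * K * ε →
      ‖(Φ u - Φ v) - A (u - v)‖ ≤ Q * (‖u - u₀‖ + ‖v - u₀‖) * ‖u - v‖) →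
    8 * K ^ 2 * Q * ε < 1 →
    ∃ u : E, ‖u - u₀‖ ≤ 2 * K * ε ∧ Φ u = 0

end Summit.NavierStokesRegularity.NavierStokesRegularity.Cruxes.CoreGluingGivenInvertibility.Ideator2
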